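import Literature.NumberTheory.Automorphic.UnitaryCurveHolCotFormsCompactness
import Mathlib.Topology.ContinuousMap.Bounded.ArzelaAscoli
import Mathlib.Analysis.Normed.Module.FiniteDimension
import HarnessLib

/-!
# Right-`K`-invariant cone-holomorphic cotangent forms of an anisotropic rank-2 unitary group form a FINITE-DIMENSIONAL space
# (compact quotient ∕ Arzelà–Ascoli ∕ Montel — no disc model, no uniformised pieces)

Topic `NumberTheory/Automorphic`; namespace `Literature.NumberTheory.Automorphic.UnitaryCurveForms`.  THEOREMS ONLY (no `def`, no instance, no
notation, no named fact, no `sorry`).  Inputs: ★ `UnitaryCurveHolCotFormsCompactness` (representatives, equicontinuity, closedness), Mathlib's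
Arzelà–Ascoli (`BoundedContinuousFunction.arzela_ascoli₂`) and Riesz (`FiniteDimensional.of_isCompact_closedBall₀`).

MAIN THEOREM `finite_holCotForms₂_inf_fixedPoints` — for the rank-2 unitary datum `(F, E, c, J, hc, hfix, w₁)` of ★ `UnitaryCurveCohCotangentForms`, a cone
frame `𝔣` with `σ_{w₁}J` hermitian, `[LocallyCompactSpace U(J)(𝔸_F)]` and `[CompactSpace (U(J)(F)\U(J)(𝔸_F))]` (both ★ for the CM datum of an
ANISOTROPIC `J`: `locallyCompactSpace_cmDatum_Adelic`, `compactSpace_cmDatum_automorphicQuotient`), and an OPEN subgroup `K ≤ U(J)(𝔸_{F,f})`: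
**`holCotForms₂ 𝔣 ⊓ (rightRep₂)^K` is finite-dimensional** ([BorelJacquet1979, §4.3 (i)] «the space of automorphic forms of a given type is finite
dimensional» (Harish-Chandra) — here the elementary COMPACT-QUOTIENT case; [Borel1997, §8]).  Proof: restrict to the compact set of representatives
`D` (an injective linear map into `C(D, ℂ)` with the sup norm); the image of the sup-unit-ball is equicontinuous (§2 of the prequel), closed (§3) and
bounded, hence COMPACT (Arzelà–Ascoli); so the unit ball of the range is compact and the range is finite-dimensional (Riesz), hence so is the space.
Cell `hodgecm-mathlib`, floor 0, K-lane of the P5 named fact E₂ (`UnitaryCurveForms.cohIsotypicLine₂_hol`): the analytic core of the cut S3₂ «a `σ`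
realised in the cone-holomorphic cotangent forms is ADMISSIBLE» (closer `Summits/…/Theorems/HLiu418E2Admissible`).  Seat F0P5-p04 (g2).  HC_CM is proved
only modulo the printed citations until rung 0 closes; nothing printed is asserted here.

## References
* [BorelJacquet1979] A. Borel, H. Jacquet, *Automorphic forms and automorphic representations*, PSPM 33.1 (1979), §4.2–§4.3 (4.3 (i)).
* [Borel1997] A. Borel, *Automorphic forms on SL₂(ℝ)*, Cambridge Tracts in Math. 130 (1997), §8 (finite dimensionality).
* [Conway1978] J. B. Conway, *Functions of One Complex Variable I* (1978), VII Thm. 2.9 (Montel), the model of the compactness argument.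
-/

set_option autoImplicit false

noncomputable section

open NumberField NumberField.InfinitePlace Topology Matrix Filter Metric Set
open scoped Matrix MatrixGroups ComplexConjugate ComplexOrder Topology Pointwise BoundedContinuousFunction

namespace Literature.NumberTheory.Automorphic

namespace UnitaryCurveForms

open UnitaryGroup Literature.AlgebraicGeometry.ShimuraVarieties Literature.AlgebraicGeometry.ShimuraVarieties.UnitaryCurveCone

variable (F E : Type) [Field F] [NumberField F] [Field E] [NumberField E] [Algebra F E]
  (c : E ≃ₐ[F] E) (J : Matrix (Fin 2) (Fin 2) E)
  (hc : c ≠ 1) (hfix : ∀ w : InfinitePlace E, c • w = w) (w₁ : {w : InfinitePlace E // IsComplex w})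

/-! ## §4 Arzelà–Ascoli on the representatives and Riesz: finite dimension -/

/-- **FINITE DIMENSIONALITY OF RIGHT-`K`-INVARIANT HOLOMORPHIC COTANGENT FORMS** (compact quotient): for an OPEN subgroup `K ≤ U(J)(𝔸_{F,f})`, the
space `holCotForms₂ 𝔣 ⊓ (rightRep₂)^K` is finite-dimensional.  Proof: §1–§3 + Arzelà–Ascoli on a compact set of representatives + Riesz.
[cite: BorelJacquet1979, §4.3 (i)] [cite: Borel1997, §8] [cite: HormanderSCV1973, Thm 2.2.7] -/
theorem finite_holCotForms₂_inf_fixedPoints [LocallyCompactSpace (adelicGroupData F E c 2 J).Adelic]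
    [CompactSpace (adelicGroupData F E c 2 J).automorphicQuotient] (𝔣 : ConeFrame E J w₁) (hJ : (J.map w₁.1.embedding).IsHermitian)
    (K : Subgroup (finAdelic F E c 2 J)) (hKo : IsOpen (K : Set (finAdelic F E c 2 J))) :
    Module.Finite ℂ ↥(holCotForms₂ F E c J hc hfix w₁ 𝔣 ⊓ (rightRep₂ F E c J).fixedPoints K) := by
  classical
  obtain ⟨D, hDc, hD⟩ := exists_isCompact_quotientSubgroup_mul F E c J
  haveI : CompactSpace D := isCompact_iff_compactSpace.1 hDc
  set V : Submodule ℂ ((adelicGroupData F E c 2 J).Adelic → ℂ) := holCotForms₂ F E c J hc hfix w₁ 𝔣 ⊓ (rightRep₂ F E c J).fixedPoints K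
    with hV
  -- unpacking membership in `V`
  have hVhol : ∀ f : V, f.1 ∈ holCotForms₂ F E c J hc hfix w₁ 𝔣 := fun f => f.2.1
  have hVK : ∀ f : V, ∀ k ∈ K, ∀ x : (adelicGroupData F E c 2 J).Adelic,
      f.1 (x * finAdelicToAdelic F E c 2 J k) = f.1 x := by
    intro f k hk x
    have h := (Representation.mem_fixedPoints _ K _).1 f.2.2 k hk
    exact congrFun h x
  have hVL : ∀ f : V, ∀ (γ : (adelicGroupData F E c 2 J).Rational) (x : (adelicGroupData F E c 2 J).Adelic),
      f.1 ((adelicGroupData F E c 2 J).toAdelic γ * x) = f.1 x :=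
    fun f => ((mem_holCotForms₂_iff F E c J hc hfix w₁ 𝔣 _).1 (hVhol f)).1
  have hVc : ∀ f : V, Continuous f.1 := fun f =>
    continuous_of_mem_holCotForms₂ F E c J hc hfix w₁ 𝔣 (hVhol f)
  -- the restriction map to the compact set of representatives
  set R : V →ₗ[ℂ] (D →ᵇ ℂ) :=
    { toFun := fun f => BoundedContinuousFunction.mkOfCompact
        (ContinuousMap.mk (fun d : D => f.1 d.1) ((hVc f).comp continuous_subtype_val))
      map_add' := fun f f' => by
        ext d
        rfl
      map_smul' := fun r f => by
        ext d
        rfl } with hR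
  have hRapply : ∀ (f : V) (d : D), R f d = f.1 d.1 := fun f d => rfl
  -- `R` is injective: a left-invariant function vanishing on `D` vanishes
  have hRinj : Function.Injective R := by
    intro f f' h
    apply Subtype.ext
    funext x
    obtain ⟨d, hd, hx⟩ := norm_le_of_norm_le_on hD (hVL (f - f')) x
    have h0 : R (f - f') ⟨d, hd⟩ = 0 := by rw [map_sub, h, sub_self]; rfl
    rw [hRapply] at h0
    have hx' : (f - f').1 x = 0 := by rw [hx]; exact h0
    exact sub_eq_zero.1 hx'
  -- the sup bound on the group from the sup bound on `D`
  have hbound : ∀ f : V, ‖R f‖ ≤ 1 → ∀ y, ‖f.1 y‖ ≤ 1 := by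
    intro f hf y
    obtain ⟨d, hd, hy⟩ := norm_le_of_norm_le_on hD (hVL f) y
    rw [hy, ← hRapply f ⟨d, hd⟩]
    exact (BoundedContinuousFunction.norm_coe_le_norm (R f) ⟨d, hd⟩).trans hf
  -- the image of the unit ball
  set S : Set (D →ᵇ ℂ) := {φ | ∃ f : V, ‖R f‖ ≤ 1 ∧ R f = φ} with hS
  have hSval : ∀ φ ∈ S, ∀ d : D, φ d ∈ closedBall (0 : ℂ) 1 := by
    rintro φ ⟨f, hf, rfl⟩ d
    rw [mem_closedBall, dist_zero_right]
    exact (BoundedContinuousFunction.norm_coe_le_norm (R f) d).trans hf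
  -- equicontinuity (§2)
  have hSequi : Equicontinuous (fun φ : S => (φ : D → ℂ)) := by
    intro d₀
    rw [Metric.equicontinuousAt_iff_right]
    intro ε hε
    obtain ⟨N, hN, hNε⟩ := exists_nhds_norm_sub_lt 𝔣 hJ hKo (d₀ : (adelicGroupData F E c 2 J).Adelic) hε
    have hN' : {d : D | (d : (adelicGroupData F E c 2 J).Adelic) ∈ N} ∈ 𝓝 d₀ := continuous_subtype_val.continuousAt.preimage_mem_nhds hN
    filter_upwards [hN'] with d hd
    rintro ⟨φ, f, hf, rfl⟩
    rw [dist_comm, dist_eq_norm]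
    exact hNε f (hVhol f) (hVK f) (hbound f hf) d hd
  -- closedness (§3)
  have hSclosed : IsClosed S := by
    refine isSeqClosed_iff_isClosed.1 fun φseq φ hφS hφlim => ?_
    choose fseq hfseq1 hfseqR using hφS
    -- the pointwise limit on the group, read through the representatives
    have hrep : ∀ y : (adelicGroupData F E c 2 J).Adelic, ∃ d ∈ D, ∀ f : V, f.1 y = f.1 d := by
      intro y
      obtain ⟨γ, hγ, d, hd, rfl⟩ := hD y
      rw [quotientSubgroup_eq_range] at hγ
      obtain ⟨γ₀, rfl⟩ := hγ
      exact ⟨d, hd, fun f => hVL f γ₀ d⟩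
    choose dOf hdOfD hdOf using hrep
    set g : (adelicGroupData F E c 2 J).Adelic → ℂ := fun y => φ ⟨dOf y, hdOfD y⟩ with hg
    have hptφ : ∀ d : D, Tendsto (fun n => φseq n d) atTop (𝓝 (φ d)) := fun d =>
      ((continuous_eval_const d : Continuous fun ψ : D →ᵇ ℂ => ψ d).tendsto φ).comp hφlim
    have hlim : ∀ y, Tendsto (fun n => (fseq n).1 y) atTop (𝓝 (g y)) := by
      intro y
      have h := hptφ ⟨dOf y, hdOfD y⟩
      refine h.congr fun n => ?_
      rw [← hfseqR n, hRapply, ← hdOf y (fseq n)]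
    obtain ⟨hghol, hgK, hgb⟩ := mem_of_tendsto 𝔣 hJ hKo (fun n => hVhol (fseq n)) (fun n => hVK (fseq n))
      (fun n => hbound (fseq n) (hfseq1 n)) hlim
    have hgV : g ∈ V := by
      refine ⟨hghol, (Representation.mem_fixedPoints _ K _).2 fun k hk => ?_⟩
      funext x
      rw [rightRep₂_apply]
      exact hgK k hk x
    refine ⟨⟨g, hgV⟩, ?_, ?_⟩
    · rw [BoundedContinuousFunction.norm_le zero_le_one]
      intro d
      exact hgb _
    · ext d
      rw [hRapply]
      have h1 : Tendsto (fun n => (fseq n).1 (d : (adelicGroupData F E c 2 J).Adelic)) atTop (𝓝 (φ d)) := by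
        refine (hptφ d).congr fun n => ?_
        rw [← hfseqR n, hRapply]
      exact tendsto_nhds_unique (hlim d) h1
  -- Arzelà–Ascoli
  have hScomp : IsCompact S :=
    BoundedContinuousFunction.arzela_ascoli₂ (closedBall (0 : ℂ) 1) (isCompact_closedBall 0 1) S hSclosed
      (fun φ d hφ => hSval φ hφ d) hSequi
  -- Riesz on the range of `R`
  set W : Submodule ℂ (D →ᵇ ℂ) := LinearMap.range R with hW
  have hball : Subtype.val '' closedBall (0 : W) 1 = S := by
    ext φ
    constructor
    · rintro ⟨w, hw, rfl⟩
      obtain ⟨f, hf⟩ := LinearMap.mem_range.1 w.2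
      rw [mem_closedBall, dist_zero_right] at hw
      refine ⟨f, ?_, hf⟩
      rw [hf]; exact hw
    · rintro ⟨f, hf, rfl⟩
      refine ⟨⟨R f, LinearMap.mem_range_self R f⟩, ?_, rfl⟩
      rw [mem_closedBall, dist_zero_right]
      exact hf
  have hWcomp : IsCompact (closedBall (0 : W) 1) := by
    rw [Topology.IsEmbedding.subtypeVal.isCompact_iff, hball]
    exact hScomp
  haveI : FiniteDimensional ℂ W := FiniteDimensional.of_isCompact_closedBall₀ ℂ one_pos hWcomp
  exact Module.Finite.equiv (LinearEquiv.ofInjective R hRinj).symm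

end UnitaryCurveForms

end Literature.NumberTheory.Automorphic

end
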